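import Summits.HodgeConjecture.HodgeConjecture.Theorems.R90S9DefiniteAeRigidityCutStable    -- ★ (this seat, (δ6s) (S1)): the ROUTE-AGNOSTIC engine `definiteAeRigidityAt_of_thm1461'` — (14.6.1) as ONE input
import Summits.HodgeConjecture.HodgeConjecture.Theorems.R90S9DefiniteAeRigidityPayLine      -- ★ p863000 (this seat, (δ6c)) — imported for its ★ CONE ONLY: (α) pins, (L), `sec146_of_levels'`, DeepLevelCert, PisSlots, J10, (MN-cm), (e), `Ch14Bridge`
import Summits.HodgeConjecture.HodgeConjecture.Theorems.R90S9HcoeffMemAtUnitsOfRecordPartnerA -- ★ p863643 (R90-IF-p03 (g3), (LF-cut) (2)): `hcoeffMem_binder_gammaSph_recordSCD_atUnitsOfRecord_partnerA'` — ROW-34 TOKEN with the `tsum` level identities asked AT A-PACKETS ONLY (`hlevTA`)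
import Summits.HodgeConjecture.HodgeConjecture.Theorems.R90S9EvpRigidityOfCore           -- ★ p863121 (R90-IF-p04 (g2), (e5′)): `InnerFormSec146.gradeRep_eq_of_evpRigidityCore` — `hrig` at a Gelfand level from the S5 CORE `hcore`
import Summits.HodgeConjecture.HodgeConjecture.Theorems.R90S9HmnAtDeepLevelDatumA            -- ★ p863705 (R90-IF-p07 (g2), (LF-3)): §1 `R90.S9.hasSum_fibre_indicator_of_tsum_eq_at` (pointwise adapter); cone ★ p863577 `eq1462LevelTsum_at_of_thm1461_of_separation'` + ★ p863655 `hmn_of_levels_of_partnerA`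
import HarnessLib

/-!
# R90-TF · S9 «InnerForm-13.3.6 (c)» — (δ6s-A) `definiteAeRigidity_payLine_stableA`: ★ (δ6s) `definiteAeRigidity_payLine_stable` (p863365) WITH THE BINDER `hlifts : ∀ P, (X.G.lifts P).Finite`
# STRUCK — ED. 5 groundwork for the strike of `sock_S9_liftsFinite_cm` (Rogawski 1990 §14.6 Thm. 14.6.1 p. 241, (14.6.2) p. 242, Thm. 14.6.4 p. 244; §13.3 Thm. 13.3.7 «`Card Π̂ ∈ {1, 2, 4}`», p. 203)

Cell `hodgecm-mathlib`, crux H413 (`stmt-HodgeConjecture-24833`, `--supports … --as helper`), route of record `HCCMUnconditional` (no route verbs; count-neutral).  Programme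
R90-TF (HUMAN RULING «R90-TF SLAB — MAX PUSH»; brief `director/R90-BRIEF.v2.md` 1f40d54518340a35), section S9 = InnerForm-13.3.6 (c) (base `R90-IF`); seat R90-IF-p07 (g2), typed as
the (S2) link of the (LF-cut) chain for the head's owner R90-IF-p06 (dealer R90-IF-plan (g2) RULING (LF-cut) 2026-09-05T00:21:03Z «the strike of `sock_S9_liftsFinite_cm` is BOOKED FOR
ED. 5 as a pure swap»; DEAL (LF-3) 00:30:42Z ∕ 00:33:18Z; p07's offer (ⅰ) 00:39:39Z «the (S1)∕(S2) A-editions as GREEN cands»).  R90-IF-p03 (g3)'s census «ALL USES GUARDED»: in ★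
p863365 the binder `hlifts` is read ONLY inside `hlevT` (★ p862413 `eq1462LevelTsum_of_thm1461_of_separation'`, the `H`-fibre at the graded packet), and `hlevT` is read ONLY by
`hmn` (★ p862961 §1) and `hcoeffMem` (★ p863200) AT A-PACKETS `P = Π(ξ)` with `ξ` in hand — where `lifts P = {ξ}` (`hlifts1`, S5 `sock_S9_lifts1_cm`) makes `Π̂(P)` finite.
THIS FILE = ★ p863365 TOKEN FOR TOKEN with: the binder `(hlifts : ∀ P : X.G.Packet, (X.G.lifts P).Finite)` DELETED (nothing in its place); `hlevT ↦ hlevTA :=` ★ p863577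
`eq1462LevelTsum_at_of_thm1461_of_separation'` (same 20 pin arguments, the conclusion at ONE graded packet with `hfin : (lifts P).Finite`); `hmn :=` ★ p863655
`hmn_of_levels_of_partnerA` with its `hlevA` slot filled POINTWISE by ★ p863705 §1 `hasSum_fibre_indicator_of_tsum_eq_at … (hχ𝓕 l f′ _).1 … (hlevTA … (lifts P = {ξ} ⊆-finite))`;
`hcoeffMem :=` ★ p863643 `hcoeffMem_binder_gammaSph_recordSCD_atUnitsOfRecord_partnerA'` with `hlevTA` guarded the same way; EVERYTHING ELSE — the 72 other binders, (S1) ★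
`definiteAeRigidityAt_of_thm1461'`, `sec146_of_levels'`, the (α) pins, the CONCLUSION (the (S-G) tail of ★ `definiteXiMembership_of_ch14`'s `hRig` BYTE FOR BYTE) — VERBATIM.
The (δ6s′-A) corollary discharging `hAFS` (★ p863495's twin) is the sibling file `R90S9DefiniteAeRigidityStableRouteArchA`.
PROOF SKELETON otherwise = ★ p863365's (J8-R1∕R2 `h61 := Ch14Bridge.thm1461_of_thm1451b Γ₀ … hG hH61 hvan hvanH h51`, `hχ𝓕 :=` J10 ★ `chiExpansion_gammaSph_of_allClasses_tensOfPair_levels`, `l₀ :=`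
the Gelfand level, `hrig :=` ★ `gradeRep_eq_of_evpRigidityCore` from `hcore`, then ★ `definiteAeRigidityAt_of_thm1461'` at `Γ₀ := gammaSph … X` with `h64 := sec146_of_levels' …`, (α) pins
`gammaSph_dSplit`, `classOfSph`, `gammaSph_m'_ne_zero`, `aeString_of_ae`, `evpRep_of_ae_of_evp_piXiPrime`, `sgTail_of_ae_of_recordSCD` — every pin BY THE SAME ★ NAME; see ★ p863365's docstring).
RESIDUAL BINDERS = (δ6s)'s minus `hlifts`: `h51k SθG SθH PSVanish PSVanishH hG hH61 hvan hvanH Pξ hA hevpXi`; `μv ν νinf hAFS hPH X htrX hspecAll`; `tw twH hTw hTHw`; `hEP hEH`; `hsepL`;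
`hcoverR hcover𝓣`; `hframe`; `htP hliftE hlifts1 hn hnH`; `hli`; `hex`; `hcore`; `hvan144G hvan144H`; `hDisj`; `htri hApkt`; (CMP) letters `hdef hquad hF1b hARCH p hp a₀ ha₀ hR₁ hR₂`.
THEOREMS ONLY (no `def`∕instance∕notation∕named fact∕`sorry`); imports ★ only; axioms TRIO.  HONEST LABEL: HC_CM is proved only modulo the 7 printed citations (2 remaining named
inputs: hLiu418 = stmt-HodgeConjecture-24832, h413 = stmt-HodgeConjecture-24833) until rung 0 closes; a pay-line SHAPE over named letters with ONE letter fewer — S9 tree sockets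
unchanged until FILE B ED. 5 is WRITTEN + BUILT; REL ≠ ★ ≠ BUILT.
[cite: Rogawski1990, §14.5 Thm. 14.5.1 (b) p. 238; §14.6 Thm. 14.6.1 p. 241, p. 242, (14.6.2)–(14.6.3), Thm. 14.6.4 pp. 244–245; §13.6 Prop. 13.6.1 p. 208; §13.3 Thm. 13.3.5 p. 202, Thm. 13.3.7 pp. 202–203; §13.7 p. 206; §14.4 Props. 14.4.1 (a), 14.4.2 (c)]
[cite: FlathCorvallis1979, Thm. 3] [cite: LabesseLanglands1979, Lemma 6.1] [cite: CartierCorvallis1979, §IV.1 Cor. 4.1]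
-/

set_option autoImplicit false
-- the mandated namespace repeats `HodgeConjecture.HodgeConjecture`, as in every `Theorems/*.lean` of this sub-problem
set_option linter.dupNamespace false
noncomputable section
open NumberField IsDedekindDomain MeasureTheory
open scoped Matrix ComplexOrder
open Literature.NumberTheory Literature.NumberTheory.Automorphic Literature.NumberTheory.Automorphic.UnitaryGroup
open Literature.NumberTheory.Automorphic.IdeleClassGroup
open Literature.NumberTheory.GaloisRepresentations
open Literature.NumberTheory.Rogawski1990
open Literature.RepresentationTheory.KonnoKonno2007 Literature.RepresentationTheory.KonnoKonno2007.RealDualPair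
open Literature.RepresentationTheory.KonnoKonno2007.RealDualPair.UForm
open Literature.NumberTheory.Automorphic.UnitaryGroup.CotangentForms (cmCompactFactor)
namespace Summit.HodgeConjecture.HodgeConjecture.R90.S9
open Summit.HodgeConjecture.HodgeConjecture.Cruxes.H413
open Summit.HodgeConjecture.HodgeConjecture.Cruxes.H413.F0P3GlobalPacket Summit.HodgeConjecture.HodgeConjecture.Cruxes.H413.F0P3LocalPacketKit
open Summit.HodgeConjecture.HodgeConjecture.Cruxes.H413.F0P3XiPacketFamilyOfRecordSCD (xiPacketFamilyOfRecordSCD hSCD_of_cmCharIdentityPackageTestSigned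
  hSCD_of_cmCharIdentityPackageTestSigned_fst)
open scoped Classical in
set_option synthInstance.maxHeartbeats 400000 in
set_option maxHeartbeats 8000000 in
/-- **(δ6s-A) `definiteAeRigidity_payLine_stableA`** — ★ (δ6s) `definiteAeRigidity_payLine_stable` (p863365) with the binder `(hlifts : ∀ P : X.G.Packet, (X.G.lifts P).Finite)` DELETED and nothing in its place (ED. 5: `sock_S9_liftsFinite_cm` leaves FILE B); every other binder and the CONCLUSION (the (S-G) tail of `hRig` BYTE FOR BYTE) VERBATIM.  Inside: `hlevTA :=` ★ p863577 `eq1462LevelTsum_at_of_thm1461_of_separation'` (the `tsum` level identity AT ONE graded packet with `|Π̂(P)| < ∞` asked there), read at the A-packets `P = Π(ξ)` of `hmn` (★ p863655 `hmn_of_levels_of_partnerA`, `HasSum` currency by ★ p863705 §1) and `hcoeffMem` (★ p863643 `…_partnerA'`) with `|Π̂(P)| < ∞` from `lifts P = {ξ}` (`hlifts1`); `h61 := Ch14Bridge.thm1461_of_thm1451b hG hH61 hvan hvanH h51` (Prop. 13.6.1-readings + Thm. 14.5.1 (b) ⟹ (14.6.1), p. 241), then the ★ payers of (α)…(δ6s)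 BY NAME over ★ `definiteAeRigidityAt_of_thm1461'`. [cite: Rogawski1990, §14.6 Thm. 14.6.1 p. 241, p. 242 (14.6.2), Thm. 14.6.4 p. 244; §14.5 Thm. 14.5.1 (b) p. 238; §13.6 Prop. 13.6.1 p. 208; §13.3 Thm. 13.3.7 pp. 202–203, p. 203] -/
theorem definiteAeRigidity_payLine_stableA
    (L : Type) [Field L] [NumberField L] [IsCMField L] (H : Matrix (Fin 3) (Fin 3) L)
    (hH : (H.map (cmConjRingHom L))ᵀ = H) (hHd : IsUnit H.det)
    [∀ v : HeightOneSpectrum (𝓞 ↥(maximalRealSubfield L)), MeasurableSpace ((cmDatum L 3 H).Local v)]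
    [∀ v : HeightOneSpectrum (𝓞 ↥(maximalRealSubfield L)), MeasurableSpace ((cmDatum L 2 (Matrix.of fun i j : Fin 2 => if i.val + j.val + 1 = 2 then (1 : L) else 0)).Local v × (cmDatum L 1 (Matrix.of fun i j : Fin 1 => if i.val + j.val + 1 = 1 then (1 : L) else 0)).Local v)]
    [∀ (v : HeightOneSpectrum (𝓞 ↥(maximalRealSubfield L))) (a : ((cmDatum L 2 (Matrix.of fun i j : Fin 2 => if i.val + j.val + 1 = 2 then (1 : L) else 0)).Local v × (cmDatum L 1 (Matrix.of fun i j : Fin 1 => if i.val + j.val + 1 = 1 then (1 : L) else 0)).Local v)),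
      MeasurableSpace (((cmDatum L 2 (Matrix.of fun i j : Fin 2 => if i.val + j.val + 1 = 2 then (1 : L) else 0)).Local v × (cmDatum L 1 (Matrix.of fun i j : Fin 1 => if i.val + j.val + 1 = 1 then (1 : L) else 0)).Local v) ⧸
        Subgroup.centralizer ({a} : Set ((cmDatum L 2 (Matrix.of fun i j : Fin 2 => if i.val + j.val + 1 = 2 then (1 : L) else 0)).Local v × (cmDatum L 1 (Matrix.of fun i j : Fin 1 => if i.val + j.val + 1 = 1 then (1 : L) else 0)).Local v)))]
    [∀ (v : HeightOneSpectrum (𝓞 ↥(maximalRealSubfield L))) (γ : (cmDatum L 3 H).Local v), MeasurableSpace ((cmDatum L 3 H).Local v ⧸ Subgroup.centralizer ({γ} : Set ((cmDatum L 3 H).Local v)))]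
    (Δ : ∀ v : HeightOneSpectrum (𝓞 ↥(maximalRealSubfield L)), LocalTransferFactor L H v)
    (mH : ∀ v : HeightOneSpectrum (𝓞 ↥(maximalRealSubfield L)), OrbitalMeasureFamily ((cmDatum L 2 (Matrix.of fun i j : Fin 2 => if i.val + j.val + 1 = 2 then (1 : L) else 0)).Local v × (cmDatum L 1 (Matrix.of fun i j : Fin 1 => if i.val + j.val + 1 = 1 then (1 : L) else 0)).Local v))
    (mG : ∀ v : HeightOneSpectrum (𝓞 ↥(maximalRealSubfield L)), OrbitalMeasureFamily ((cmDatum L 3 H).Local v))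
    (νG : ∀ v : HeightOneSpectrum (𝓞 ↥(maximalRealSubfield L)), Measure ((cmDatum L 3 H).Local v))
    (νH : ∀ v : HeightOneSpectrum (𝓞 ↥(maximalRealSubfield L)), Measure ((cmDatum L 2 (Matrix.of fun i j : Fin 2 => if i.val + j.val + 1 = 2 then (1 : L) else 0)).Local v × (cmDatum L 1 (Matrix.of fun i j : Fin 1 => if i.val + j.val + 1 = 1 then (1 : L) else 0)).Local v))
    [∀ v : HeightOneSpectrum (𝓞 ↥(maximalRealSubfield L)), BorelSpace ((cmDatum L 3 H).Local v)]
    [∀ v : HeightOneSpectrum (𝓞 ↥(maximalRealSubfield L)), BorelSpace ((cmDatum L 2 (Matrix.of fun i j : Fin 2 => if i.val + j.val + 1 = 2 then (1 : L) else 0)).Local v × (cmDatum L 1 (Matrix.of fun i j : Fin 1 => if i.val + j.val + 1 = 1 then (1 : L) else 0)).Local v)]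
    [∀ (v : HeightOneSpectrum (𝓞 ↥(maximalRealSubfield L))) (a : ((cmDatum L 2 (Matrix.of fun i j : Fin 2 => if i.val + j.val + 1 = 2 then (1 : L) else 0)).Local v × (cmDatum L 1 (Matrix.of fun i j : Fin 1 => if i.val + j.val + 1 = 1 then (1 : L) else 0)).Local v)),
      BorelSpace (((cmDatum L 2 (Matrix.of fun i j : Fin 2 => if i.val + j.val + 1 = 2 then (1 : L) else 0)).Local v × (cmDatum L 1 (Matrix.of fun i j : Fin 1 => if i.val + j.val + 1 = 1 then (1 : L) else 0)).Local v) ⧸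
        Subgroup.centralizer ({a} : Set ((cmDatum L 2 (Matrix.of fun i j : Fin 2 => if i.val + j.val + 1 = 2 then (1 : L) else 0)).Local v × (cmDatum L 1 (Matrix.of fun i j : Fin 1 => if i.val + j.val + 1 = 1 then (1 : L) else 0)).Local v)))]
    [∀ (v : HeightOneSpectrum (𝓞 ↥(maximalRealSubfield L))) (γ : (cmDatum L 3 H).Local v), BorelSpace ((cmDatum L 3 H).Local v ⧸ Subgroup.centralizer ({γ} : Set ((cmDatum L 3 H).Local v)))]
    [∀ v, (νG v).IsHaarMeasure] [∀ v, (νG v).IsMulRightInvariant] [∀ v, (νH v).IsHaarMeasure] [∀ v, (νH v).IsMulRightInvariant]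
    (hanis : ∀ x : Fin 3 → L, Literature.AlgebraicGeometry.ShimuraVarieties.hermForm (cmConjRingHom L) H x x = 0 → x = 0)
    (μω : HeckeCharacter L) (hμu : μω.IsUnitary)
    (hμω : ∀ x : Literature.NumberTheory.GaloisRepresentations.ideleGroup ↥(maximalRealSubfield L),
      μω (AdeleRing.ideleBaseChange (↥(maximalRealSubfield L)) L x) = quadraticHeckeCharCM L x)
    (hQS : CMCharIdentityPackageTestSigned L H hH hHd νH νG μω hμu Δ mH mG)
    (ι : L →+* ℂ) (T : GL (Fin 3) ℂ)
    (hT : (T : Matrix (Fin 3) (Fin 3) ℂ)ᴴ * H.map ι * (T : Matrix (Fin 3) (Fin 3) ℂ) = Literature.Geometry.ComplexHyperbolic.BallModel.J)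
    (ξ : OneDimAutRepH L)
    (μA : Measure (adelicGroupData (↥(maximalRealSubfield L)) L (IsCMField.complexConj L) 3 H).automorphicQuotient)
    [(adelicGroupData (↥(maximalRealSubfield L)) L (IsCMField.complexConj L) 3 H).IsAutomorphicMeasure μA]
    (P : DiscreteAutomorphicRep (adelicGroupData (↥(maximalRealSubfield L)) L (IsCMField.complexConj L) 3 H) μA)
    (hsph : InnerFormSec146.IsKcSpherical L ι H T hT μA P)
    (hAE :
      (∃ S : Finset (HeightOneSpectrum (𝓞 ↥(maximalRealSubfield L))),
        (∀ v : HeightOneSpectrum (𝓞 ↥(maximalRealSubfield L)), v ∉ S →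
          ∀ (hns : ∀ w : PlacesOver L v, IsCMField.complexConj L • w.1 = w.1)
            (T : GL (Fin 3) (LocalRing L v)) (a : LocalRing L v) (ha : IsUnit a)
            (h : formCongr (conjLocal L (IsCMField.complexConj L) v) T (H.map (algebraMap L (LocalRing L v))) =
              a • (Matrix.of fun i j : Fin 3 => if i.val + j.val + 1 = 3 then (1 : L) else 0).map (algebraMap L (LocalRing L v))),
          ∀ [MeasurableSpace (Gqs L v ⧸ Subgroup.center (Gqs L v))] [BorelSpace (Gqs L v ⧸ Subgroup.center (Gqs L v))]
            (μZ : Measure (Gqs L v ⧸ Subgroup.center (Gqs L v))) [μZ.IsHaarMeasure],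
          ∀ (π2 πn : IrrClass (Gqs L v)),
            KeysCaseTwoLabels L v (μω.semilocalComponent L v) (torusLocalComponent L (IsCMField.complexConj L) v ξ.η)
              (torusLocalComponent L (IsCMField.complexConj L) v ξ.ψ) π2 πn →
            ¬ πn.IsSquareIntegrable μZ →
            ∀ c : IrrClass ((cmDatum L 3 H).Local v),
              (IrrClass.comap (localPiEquiv L (IsCMField.complexConj L) 3 H v) c).IsConstituentOf
                  (P.finRep.smoothPart.toRepresentation.comp (inclPlace (↥(maximalRealSubfield L)) L (IsCMField.complexConj L) 3 H v)) →
              c = IrrClass.comap (cmDatumLocalCongr L v T ha h).symm πn) ∧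
        (∀ v : HeightOneSpectrum (𝓞 ↥(maximalRealSubfield L)), v ∉ S →
          ∀ (hs : ∃ w : PlacesOver L v, IsCMField.complexConj L • w.1 ≠ w.1),
            ∀ c : IrrClass ((cmDatum L 3 H).Local v),
              (IrrClass.comap (localPiEquiv L (IsCMField.complexConj L) 3 H v) c).IsConstituentOf
                  (P.finRep.smoothPart.toRepresentation.comp (inclPlace (↥(maximalRealSubfield L)) L (IsCMField.complexConj L) 3 H v)) →
              c ∈ (cmSplitPacket L H hH hHd v (splitWitness v hs) (splitWitness_spec v hs) (ξ.splitν₀ μω (splitWitness v hs).1)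
                (ξ.locψ (splitWitness v hs).1) (ξ.norm_splitν₀_apply hμu (splitWitness v hs).1)
                (ξ.continuous_splitν₀ μω (splitWitness v hs).1) (ξ.norm_locψ_apply (splitWitness v hs).1)
                (ξ.continuous_locψ (splitWitness v hs).1)).members)))
    [∀ v : HeightOneSpectrum (𝓞 ↥(maximalRealSubfield L)), MeasurableSpace (Gqs L v ⧸ Subgroup.center (Gqs L v))]
    [∀ v : HeightOneSpectrum (𝓞 ↥(maximalRealSubfield L)), BorelSpace (Gqs L v ⧸ Subgroup.center (Gqs L v))]
    (μZ : ∀ v : HeightOneSpectrum (𝓞 ↥(maximalRealSubfield L)), Measure (Gqs L v ⧸ Subgroup.center (Gqs L v)))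
    [∀ v : HeightOneSpectrum (𝓞 ↥(maximalRealSubfield L)), (μZ v).IsHaarMeasure]
    (keys : ∀ (ξ : OneDimAutRepH L) (v : HeightOneSpectrum (𝓞 ↥(maximalRealSubfield L))),
      (∀ w : PlacesOver L v, IsCMField.complexConj L • w.1 = w.1) →
        {p : IrrClass (Gqs L v) × IrrClass (Gqs L v) //
          KeysCaseTwoLabels L v (μω.semilocalComponent L v) (torusLocalComponent L (IsCMField.complexConj L) v ξ.η)
            (torusLocalComponent L (IsCMField.complexConj L) v ξ.ψ) p.1 p.2 ∧
          p.1.IsSquareIntegrable (μZ v) ∧ ¬ p.2.IsSquareIntegrable (μZ v)})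
    {H' : Matrix (Fin 3) (Fin 3) L} (𝔩 : ∀ v : HeightOneSpectrum (𝓞 ↥(maximalRealSubfield L)), LocalPacketKit L H' v)
    (μv : ∀ v : HeightOneSpectrum (𝓞 ↥(maximalRealSubfield L)), @Measure ((cmDatum L 3 H).Local v) (borel _))
    [MeasurableSpace (adelicGroupData (↥(maximalRealSubfield L)) L (IsCMField.complexConj L) 3 H).Adelic] [BorelSpace (adelicGroupData (↥(maximalRealSubfield L)) L (IsCMField.complexConj L) 3 H).Adelic]
    (ν : Measure (adelicGroupData (↥(maximalRealSubfield L)) L (IsCMField.complexConj L) 3 H).Adelic) [IsFiniteMeasureOnCompacts ν]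
    (νinf : @Measure (UnitaryGroup.arch (↥(maximalRealSubfield L)) L (IsCMField.complexConj L) 3 H) (borel _))
    (hAFS : F0P3LettersArchFinTraceSplit.ArchFinTraceSplit L H ι T hT μA ν νinf μv)
    (hPH : F0P3LettersTraceFactorisation.IsProductHaar L H ν νinf μv)
    (X : InnerFormSec146.DatumInputs ((UnitaryGroup.arch (↥(maximalRealSubfield L)) L (IsCMField.complexConj L) 3 H → ℂ) ×
      (∀ v : HeightOneSpectrum (𝓞 ↥(maximalRealSubfield L)), (cmDatum L 3 H).Local v → ℂ))
      (CompactlySupportedContinuousMap (cmDatum L 3 (Matrix.of fun i j : Fin 3 => if i.val + j.val + 1 = 3 then (1 : L) else 0)).Adelic ℂ)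
      (CompactlySupportedContinuousMap ((cmDatum L 2 (Matrix.of fun i j : Fin 2 => if i.val + j.val + 1 = 2 then (1 : L) else 0)).Adelic × (cmDatum L 1 (Matrix.of fun i j : Fin 1 => if i.val + j.val + 1 = 1 then (1 : L) else 0)).Adelic) ℂ) L ι H T hT μA
      (xiPacketFamilyOfRecordSCD L H hH hHd μω hμu μZ keys (hSCD_of_cmCharIdentityPackageTestSigned L H hH hHd μω hμu Δ mH mG νG νH μZ hQS)) 𝔩)
    (htrX : ∀ (π' : (InnerFormSec146.RepPrimeSph L ι H T hT μA)) (p : ((UnitaryGroup.arch (↥(maximalRealSubfield L)) L (IsCMField.complexConj L) 3 H → ℂ) ×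
      (∀ v : HeightOneSpectrum (𝓞 ↥(maximalRealSubfield L)), (cmDatum L 3 H).Local v → ℂ))),
      X.trPrime π' p = archTr₀ L ι H T hT νinf (InnerFormSec146.tupleOf L ι H T hT μA π').1 p.1 *
        ∏ᶠ v, (letI : MeasurableSpace ((cmDatum L 3 H).Local v) := borel _;
          ((InnerFormSec146.tupleOf L ι H T hT μA π').2 v).smoothTrace (μv v) (p.2 v)))
    (hspecAll : ∀ (l : InnerFormSec146.Level L) (p : ((UnitaryGroup.arch (↥(maximalRealSubfield L)) L (IsCMField.complexConj L) 3 H → ℂ) ×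
      (∀ v : HeightOneSpectrum (𝓞 ↥(maximalRealSubfield L)), (cmDatum L 3 H).Local v → ℂ))),
      InnerFormSec146.IsLevelTest L ι H T hT l p →
        Summable (fun c : InnerFormSec146.RepPrimeClass L H μA =>
          (InnerFormSec146.mPrime L H μA c : ℂ) * F0P3SpectralSideOfRecord.trGp₀ (adelicGroupData (↥(maximalRealSubfield L)) L (IsCMField.complexConj L) 3 H) μA ν c (tensOfPair L H ι T hT p)) ∧
        X.traceL p = ∑' c : InnerFormSec146.RepPrimeClass L H μA,
          (InnerFormSec146.mPrime L H μA c : ℂ) * F0P3SpectralSideOfRecord.trGp₀ (adelicGroupData (↥(maximalRealSubfield L)) L (IsCMField.complexConj L) 3 H) μA ν c (tensOfPair L H ι T hT p))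
    (Smooth : ((UnitaryGroup.arch (↥(maximalRealSubfield L)) L (IsCMField.complexConj L) 3 H → ℂ) ×
      (∀ v : HeightOneSpectrum (𝓞 ↥(maximalRealSubfield L)), (cmDatum L 3 H).Local v → ℂ)) → Prop)
    (Transfer : ((UnitaryGroup.arch (↥(maximalRealSubfield L)) L (IsCMField.complexConj L) 3 H → ℂ) ×
      (∀ v : HeightOneSpectrum (𝓞 ↥(maximalRealSubfield L)), (cmDatum L 3 H).Local v → ℂ)) → (CompactlySupportedContinuousMap (cmDatum L 3 (Matrix.of fun i j : Fin 3 => if i.val + j.val + 1 = 3 then (1 : L) else 0)).Adelic ℂ) → Prop)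
    (TransferH : ((UnitaryGroup.arch (↥(maximalRealSubfield L)) L (IsCMField.complexConj L) 3 H → ℂ) ×
      (∀ v : HeightOneSpectrum (𝓞 ↥(maximalRealSubfield L)), (cmDatum L 3 H).Local v → ℂ)) → (CompactlySupportedContinuousMap ((cmDatum L 2 (Matrix.of fun i j : Fin 2 => if i.val + j.val + 1 = 2 then (1 : L) else 0)).Adelic × (cmDatum L 1 (Matrix.of fun i j : Fin 1 => if i.val + j.val + 1 = 1 then (1 : L) else 0)).Adelic) ℂ) → Prop)
    (SθG : (CompactlySupportedContinuousMap (cmDatum L 3 (Matrix.of fun i j : Fin 3 => if i.val + j.val + 1 = 3 then (1 : L) else 0)).Adelic ℂ) → ℂ)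
    (SθH : (CompactlySupportedContinuousMap ((cmDatum L 2 (Matrix.of fun i j : Fin 2 => if i.val + j.val + 1 = 2 then (1 : L) else 0)).Adelic × (cmDatum L 1 (Matrix.of fun i j : Fin 1 => if i.val + j.val + 1 = 1 then (1 : L) else 0)).Adelic) ℂ) → ℂ)
    (h51k : ∀ (f' : ((UnitaryGroup.arch (↥(maximalRealSubfield L)) L (IsCMField.complexConj L) 3 H → ℂ) ×
      (∀ v : HeightOneSpectrum (𝓞 ↥(maximalRealSubfield L)), (cmDatum L 3 H).Local v → ℂ)))
      (f : (CompactlySupportedContinuousMap (cmDatum L 3 (Matrix.of fun i j : Fin 3 => if i.val + j.val + 1 = 3 then (1 : L) else 0)).Adelic ℂ))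
      (fH : (CompactlySupportedContinuousMap ((cmDatum L 2 (Matrix.of fun i j : Fin 2 => if i.val + j.val + 1 = 2 then (1 : L) else 0)).Adelic × (cmDatum L 1 (Matrix.of fun i j : Fin 1 => if i.val + j.val + 1 = 1 then (1 : L) else 0)).Adelic) ℂ)),
      Smooth f' → Transfer f' f ∧ TransferH f' fH → X.traceL f' = SθG f + (1 / 2 : ℂ) * SθH fH)
    (PSVanish : (CompactlySupportedContinuousMap (cmDatum L 3 (Matrix.of fun i j : Fin 3 => if i.val + j.val + 1 = 3 then (1 : L) else 0)).Adelic ℂ) → Prop)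
    (PSVanishH : (CompactlySupportedContinuousMap ((cmDatum L 2 (Matrix.of fun i j : Fin 2 => if i.val + j.val + 1 = 2 then (1 : L) else 0)).Adelic × (cmDatum L 1 (Matrix.of fun i j : Fin 1 => if i.val + j.val + 1 = 1 then (1 : L) else 0)).Adelic) ℂ) → Prop)
    -- J8-R1: THE G-SIDE DISCRETE EXPANSION OF RECORD IS THE STABLE ONE (Prop. 13.6.1-reading «SΘ_G(f) = Σ n(Π) Tr Π(f)» on the vanishing class) — B: `sock_S9_stableSpecG_cm`
    (hG : X.G.StableDiscreteExpansionG X.tr SθG PSVanish)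
    (hH61 : X.G.StableDiscreteExpansionH X.trH SθH PSVanishH)
    (hvan : ∀ (f' : ((UnitaryGroup.arch (↥(maximalRealSubfield L)) L (IsCMField.complexConj L) 3 H → ℂ) ×
      (∀ v : HeightOneSpectrum (𝓞 ↥(maximalRealSubfield L)), (cmDatum L 3 H).Local v → ℂ)))
      (f : (CompactlySupportedContinuousMap (cmDatum L 3 (Matrix.of fun i j : Fin 3 => if i.val + j.val + 1 = 3 then (1 : L) else 0)).Adelic ℂ)), Smooth f' ∧ Transfer f' f → PSVanish f)
    (hvanH : ∀ (f' : ((UnitaryGroup.arch (↥(maximalRealSubfield L)) L (IsCMField.complexConj L) 3 H → ℂ) ×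
      (∀ v : HeightOneSpectrum (𝓞 ↥(maximalRealSubfield L)), (cmDatum L 3 H).Local v → ℂ)))
      (fH : (CompactlySupportedContinuousMap ((cmDatum L 2 (Matrix.of fun i j : Fin 2 => if i.val + j.val + 1 = 2 then (1 : L) else 0)).Adelic × (cmDatum L 1 (Matrix.of fun i j : Fin 1 => if i.val + j.val + 1 = 1 then (1 : L) else 0)).Adelic) ℂ)), TransferH f' fH → PSVanishH fH)
    (tw : ∀ l : InnerFormSec146.Level L, InnerFormSec146.HeckeOff L H l → (CompactlySupportedContinuousMap (cmDatum L 3 (Matrix.of fun i j : Fin 3 => if i.val + j.val + 1 = 3 then (1 : L) else 0)).Adelic ℂ) → (CompactlySupportedContinuousMap (cmDatum L 3 (Matrix.of fun i j : Fin 3 => if i.val + j.val + 1 = 3 then (1 : L) else 0)).Adelic ℂ))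
    (twH : ∀ l : InnerFormSec146.Level L, InnerFormSec146.HeckeOff L H l →
      (CompactlySupportedContinuousMap ((cmDatum L 2 (Matrix.of fun i j : Fin 2 => if i.val + j.val + 1 = 2 then (1 : L) else 0)).Adelic × (cmDatum L 1 (Matrix.of fun i j : Fin 1 => if i.val + j.val + 1 = 1 then (1 : L) else 0)).Adelic) ℂ) →
      (CompactlySupportedContinuousMap ((cmDatum L 2 (Matrix.of fun i j : Fin 2 => if i.val + j.val + 1 = 2 then (1 : L) else 0)).Adelic × (cmDatum L 1 (Matrix.of fun i j : Fin 1 => if i.val + j.val + 1 = 1 then (1 : L) else 0)).Adelic) ℂ))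
    (hTw : ∀ (l : InnerFormSec146.Level L) (h : InnerFormSec146.HeckeOff L H l) (f' : ((UnitaryGroup.arch (↥(maximalRealSubfield L)) L (IsCMField.complexConj L) 3 H → ℂ) ×
      (∀ v : HeightOneSpectrum (𝓞 ↥(maximalRealSubfield L)), (cmDatum L 3 H).Local v → ℂ)))
      (f : (CompactlySupportedContinuousMap (cmDatum L 3 (Matrix.of fun i j : Fin 3 => if i.val + j.val + 1 = 3 then (1 : L) else 0)).Adelic ℂ)),
      InnerFormSec146.IsLevelTest L ι H T hT l f' → (Smooth f' ∧ Transfer f' f) →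
        (Smooth (InnerFormSec146.twistTest L H μv l h f') ∧ Transfer (InnerFormSec146.twistTest L H μv l h f') (tw l h f)))
    (hTHw : ∀ (l : InnerFormSec146.Level L) (h : InnerFormSec146.HeckeOff L H l) (f' : ((UnitaryGroup.arch (↥(maximalRealSubfield L)) L (IsCMField.complexConj L) 3 H → ℂ) ×
      (∀ v : HeightOneSpectrum (𝓞 ↥(maximalRealSubfield L)), (cmDatum L 3 H).Local v → ℂ)))
      (fH : (CompactlySupportedContinuousMap ((cmDatum L 2 (Matrix.of fun i j : Fin 2 => if i.val + j.val + 1 = 2 then (1 : L) else 0)).Adelic × (cmDatum L 1 (Matrix.of fun i j : Fin 1 => if i.val + j.val + 1 = 1 then (1 : L) else 0)).Adelic) ℂ)),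
      InnerFormSec146.IsLevelTest L ι H T hT l f' → TransferH f' fH → TransferH (InnerFormSec146.twistTest L H μv l h f') (twH l h fH))
    (hEP : ∀ (l : InnerFormSec146.Level L) (h : InnerFormSec146.HeckeOff L H l) (f' : ((UnitaryGroup.arch (↥(maximalRealSubfield L)) L (IsCMField.complexConj L) 3 H → ℂ) ×
      (∀ v : HeightOneSpectrum (𝓞 ↥(maximalRealSubfield L)), (cmDatum L 3 H).Local v → ℂ)))
      (f : (CompactlySupportedContinuousMap (cmDatum L 3 (Matrix.of fun i j : Fin 3 => if i.val + j.val + 1 = 3 then (1 : L) else 0)).Adelic ℂ)),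
      InnerFormSec146.IsLevelTest L ι H T hT l f' → (Smooth f' ∧ Transfer f' f) → ∀ P : X.G.Packet,
        X.G.packetTrace X.tr P (tw l h f) =
          ((InnerFormSec146.gradePacket _ _ _ L ι H T hT μA μv (xiPacketFamilyOfRecordSCD L H hH hHd μω hμu μZ keys (hSCD_of_cmCharIdentityPackageTestSigned L H hH hHd μω hμu Δ mH mG νG νH μZ hQS)) 𝔩 X l P).elim 0
            fun e => InnerFormSec146.evOff L H μv l e h) * X.G.packetTrace X.tr P f)
    (hEH : ∀ (l : InnerFormSec146.Level L) (h : InnerFormSec146.HeckeOff L H l) (f' : ((UnitaryGroup.arch (↥(maximalRealSubfield L)) L (IsCMField.complexConj L) 3 H → ℂ) ×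
      (∀ v : HeightOneSpectrum (𝓞 ↥(maximalRealSubfield L)), (cmDatum L 3 H).Local v → ℂ)))
      (fH : (CompactlySupportedContinuousMap ((cmDatum L 2 (Matrix.of fun i j : Fin 2 => if i.val + j.val + 1 = 2 then (1 : L) else 0)).Adelic × (cmDatum L 1 (Matrix.of fun i j : Fin 1 => if i.val + j.val + 1 = 1 then (1 : L) else 0)).Adelic) ℂ)),
      InnerFormSec146.IsLevelTest L ι H T hT l f' → TransferH f' fH → ∀ ρ : X.G.PacketH,
        X.trH ρ (twH l h fH) =
          ((InnerFormSec146.gradePacketH _ _ _ L ι H T hT μA μv (xiPacketFamilyOfRecordSCD L H hH hHd μω hμu μZ keys (hSCD_of_cmCharIdentityPackageTestSigned L H hH hHd μω hμu Δ mH mG νG νH μZ hQS)) 𝔩 X l ρ).elim 0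
            fun e => InnerFormSec146.evOff L H μv l e h) * X.trH ρ fH)
    (hsepL : ∀ l : InnerFormSec146.Level L,
      IsCountablyLinIndepOn (InnerFormSec146.EvpSupport L H μv l) (fun _ : InnerFormSec146.HeckeOff L H l => True) (InnerFormSec146.evOff L H μv l))
    (hcoverR : ∀ π' : (InnerFormSec146.RepPrimeSph L ι H T hT μA), InnerFormSec146.mPrimeSph L ι H T hT μA π' ≠ 0 → ∀ l₀ : InnerFormSec146.Level L,
      ∃ l : InnerFormSec146.Level L, l₀ ⊆ l ∧ ∃ (e : InnerFormSec146.Evp L H) (f₀ : ((UnitaryGroup.arch (↥(maximalRealSubfield L)) L (IsCMField.complexConj L) 3 H → ℂ) ×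
      (∀ v : HeightOneSpectrum (𝓞 ↥(maximalRealSubfield L)), (cmDatum L 3 H).Local v → ℂ)))
        (f : (CompactlySupportedContinuousMap (cmDatum L 3 (Matrix.of fun i j : Fin 3 => if i.val + j.val + 1 = 3 then (1 : L) else 0)).Adelic ℂ))
        (fH : (CompactlySupportedContinuousMap ((cmDatum L 2 (Matrix.of fun i j : Fin 2 => if i.val + j.val + 1 = 2 then (1 : L) else 0)).Adelic × (cmDatum L 1 (Matrix.of fun i j : Fin 1 => if i.val + j.val + 1 = 1 then (1 : L) else 0)).Adelic) ℂ)),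
        InnerFormSec146.gradeRep L ι H T hT μA μv l π' = some e ∧ InnerFormSec146.IsLevelTest L ι H T hT l f₀ ∧ (Smooth f₀ ∧ Transfer f₀ f) ∧ TransferH f₀ fH ∧
          (∀ π : (InnerFormSec146.RepPrimeSph L ι H T hT μA), 0 ≤ (InnerFormSec146.mPrimeSph L ι H T hT μA π : ℂ) * X.trPrime π f₀) ∧ (InnerFormSec146.mPrimeSph L ι H T hT μA π' : ℂ) * X.trPrime π' f₀ ≠ 0)
    (hframe : ∀ᶠ v : HeightOneSpectrum (𝓞 ↥(maximalRealSubfield L)) in Filter.cofinite,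
      ∃ (T₁ : GL (Fin 3) (LocalRing L v)) (a : LocalRing L v) (ha : IsUnit a)
        (h : formCongr (conjLocal L (IsCMField.complexConj L) v) T₁ (H.map (algebraMap L (LocalRing L v))) = a • H'.map (algebraMap L (LocalRing L v))),
        ∀ g : (cmDatum L 3 H).Local v, (cmDatumLocalCongr L v T₁ ha h).symm g ∈ cmLocalIntegralLevel L 3 H' v ↔ g ∈ cmLocalIntegralLevel L 3 H v)
    (htP : ∀ (l : InnerFormSec146.Level L) (P Q : X.G.Packet) (e : InnerFormSec146.Evp L H),
      InnerFormSec146.gradePacket _ _ _ L ι H T hT μA μv (xiPacketFamilyOfRecordSCD L H hH hHd μω hμu μZ keys (hSCD_of_cmCharIdentityPackageTestSigned L H hH hHd μω hμu Δ mH mG νG νH μZ hQS)) 𝔩 X l P = some e →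
      InnerFormSec146.gradePacket _ _ _ L ι H T hT μA μv (xiPacketFamilyOfRecordSCD L H hH hHd μω hμu μZ keys (hSCD_of_cmCharIdentityPackageTestSigned L H hH hHd μω hμu Δ mH mG νG νH μZ hQS)) 𝔩 X l Q = some e → P = Q)
    (hDisj : ∀ v : HeightOneSpectrum (𝓞 ↥(maximalRealSubfield L)), InnerFormSec146.APacketsOfRecordDisjointAt L H (xiPacketFamilyOfRecordSCD L H hH hHd μω hμu μZ keys (hSCD_of_cmCharIdentityPackageTestSigned L H hH hHd μω hμu Δ mH mG νG νH μZ hQS)) v)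
    (htri : X.G.PacketTrichotomy)
    (hApkt : ∀ P : X.G.Packet, X.G.IsAPacket P → ∃ ξ : X.G.PacketH, X.IsOneDimH ξ ∧ X.G.liftsTo ξ P)
    (hliftE : ∀ (l : InnerFormSec146.Level L) (ρ : X.G.PacketH) (P : X.G.Packet) (e : InnerFormSec146.Evp L H),
      InnerFormSec146.gradePacket _ _ _ L ι H T hT μA μv (xiPacketFamilyOfRecordSCD L H hH hHd μω hμu μZ keys (hSCD_of_cmCharIdentityPackageTestSigned L H hH hHd μω hμu Δ mH mG νG νH μZ hQS)) 𝔩 X l P = some e →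
        (X.G.liftsTo ρ P ↔ InnerFormSec146.gradePacketH _ _ _ L ι H T hT μA μv (xiPacketFamilyOfRecordSCD L H hH hHd μω hμu μZ keys (hSCD_of_cmCharIdentityPackageTestSigned L H hH hHd μω hμu Δ mH mG νG νH μZ hQS)) 𝔩 X l ρ = some e))
    -- (LF-cut) ED. 5: NO `hlifts : ∀ P, (X.G.lifts P).Finite` binder — `|Π̂(P)| < ∞` is read only at A-packets, where `lifts P = {ξ}` (`hlifts1`)
    (hnH : ∀ ξ : X.G.PacketH, X.IsOneDimH ξ → X.G.nH ξ = 1)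
    (hli : IsCountablyLinIndepOn (Set.univ : Set (InnerFormSec146.RepPrimeSph L ι H T hT μA))
      (fun φf : ((UnitaryGroup.arch (↥(maximalRealSubfield L)) L (IsCMField.complexConj L) 3 H → ℂ) ×
      (∀ v : HeightOneSpectrum (𝓞 ↥(maximalRealSubfield L)), (cmDatum L 3 H).Local v → ℂ)) =>
        (ArchTestKc L ι H T hT φf.1 ∧ (∀ v, IsLocallyConstant (φf.2 v) ∧ HasCompactSupport (φf.2 v)) ∧
        {v | φf.2 v ≠ (cmLocalIntegralLevel L 3 H v : Set ((cmDatum L 3 H).Local v)).indicator fun _ => (1 : ℂ)}.Finite))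
      (fun π' p => X.trPrime π' p))
    (hex : ∀ φf : ((UnitaryGroup.arch (↥(maximalRealSubfield L)) L (IsCMField.complexConj L) 3 H → ℂ) ×
      (∀ v : HeightOneSpectrum (𝓞 ↥(maximalRealSubfield L)), (cmDatum L 3 H).Local v → ℂ)),
      (ArchTestKc L ι H T hT φf.1 ∧ (∀ v, IsLocallyConstant (φf.2 v) ∧ HasCompactSupport (φf.2 v)) ∧
        {v | φf.2 v ≠ (cmLocalIntegralLevel L 3 H v : Set ((cmDatum L 3 H).Local v)).indicator fun _ => (1 : ℂ)}.Finite) →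
      ∃ (f : (CompactlySupportedContinuousMap (cmDatum L 3 (Matrix.of fun i j : Fin 3 => if i.val + j.val + 1 = 3 then (1 : L) else 0)).Adelic ℂ))
        (fH : (CompactlySupportedContinuousMap ((cmDatum L 2 (Matrix.of fun i j : Fin 2 => if i.val + j.val + 1 = 2 then (1 : L) else 0)).Adelic × (cmDatum L 1 (Matrix.of fun i j : Fin 1 => if i.val + j.val + 1 = 1 then (1 : L) else 0)).Adelic) ℂ)),
        (Smooth φf ∧ Transfer φf f) ∧ TransferH φf fH)
    (hcover𝓣 : ∀ f' : ((UnitaryGroup.arch (↥(maximalRealSubfield L)) L (IsCMField.complexConj L) 3 H → ℂ) ×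
      (∀ v : HeightOneSpectrum (𝓞 ↥(maximalRealSubfield L)), (cmDatum L 3 H).Local v → ℂ)),
      (ArchTestKc L ι H T hT f'.1 ∧ (∀ v, IsLocallyConstant (f'.2 v) ∧ HasCompactSupport (f'.2 v)) ∧
        {v | f'.2 v ≠ (cmLocalIntegralLevel L 3 H v : Set ((cmDatum L 3 H).Local v)).indicator fun _ => (1 : ℂ)}.Finite) → ∀ P : X.G.Packet,
      (∃ π' : (InnerFormSec146.RepPrimeSph L ι H T hT μA), InnerFormSec146.mPrimeSph L ι H T hT μA π' ≠ 0 ∧ InnerFormSec146.evpRep L H μA 𝔩 π'.1 (X.finOfG P)) →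
        ∀ l₀ : InnerFormSec146.Level L, ∃ l : InnerFormSec146.Level L, l₀ ⊆ l ∧ ∃ e : InnerFormSec146.Evp L H,
          InnerFormSec146.IsLevelTest L ι H T hT l f' ∧ InnerFormSec146.gradePacket _ _ _ L ι H T hT μA μv (xiPacketFamilyOfRecordSCD L H hH hHd μω hμu μZ keys (hSCD_of_cmCharIdentityPackageTestSigned L H hH hHd μω hμu Δ mH mG νG νH μZ hQS)) 𝔩 X l P = some e)
    -- S5 — THE E.V.P. RIGIDITY CORE per level (Thm. 13.3.5; p. 242 l. 15), p04 (g2)'s ★ p863121 socket shape `sock_S9_evpRigidityCore_cm` BYTEWISE at generic `X`: germ ⟹ transport off the level for spherical components; `hrig` is DERIVED in-file at the Gelfand levels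
    (hcore : ∀ (l : InnerFormSec146.Level L) (π' : InnerFormSec146.RepPrimeSph L ι H T hT μA) (P : X.G.Packet) (e : InnerFormSec146.Evp L H),
      InnerFormSec146.gradePacket _ _ _ L ι H T hT μA μv (xiPacketFamilyOfRecordSCD L H hH hHd μω hμu μZ keys (hSCD_of_cmCharIdentityPackageTestSigned L H hH hHd μω hμu Δ mH mG νG νH μZ hQS)) 𝔩 X l P = some e →
      (InnerFormSec146.gammaSph _ _ _ L ι H T hT μA (xiPacketFamilyOfRecordSCD L H hH hHd μω hμu μZ keys (hSCD_of_cmCharIdentityPackageTestSigned L H hH hHd μω hμu Δ mH mG νG νH μZ hQS)) 𝔩 X).evpRep π' P →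
        (∀ v, v ∉ l → ((InnerFormSec146.tupleOf L ι H T hT μA π').2 v).IsSpherical (cmLocalIntegralLevel L 3 H v)) →
          ∀ v, v ∉ l → InnerFormSec146.TransportsToSphAt L H 𝔩 v ((InnerFormSec146.tupleOf L ι H T hT μA π').2 v) ((X.finOfG P).loc v))
    (hlifts1 : ∀ (P : X.G.Packet) (ξ : X.G.PacketH), X.G.IsAPacket P → X.IsOneDimH ξ → X.G.liftsTo ξ P → X.G.lifts P = {ξ})
    (hn : ∀ (P : X.G.Packet) (ξ : X.G.PacketH), X.G.IsAPacket P → X.IsOneDimH ξ → X.G.liftsTo ξ P → X.G.n P = 1 / 2)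
    (hvan144G : ∀ (P : X.G.Packet) (ξ : X.G.PacketH) (v : InnerFormSec146.Place L), v ∈ InnerFormSec146.S0 L H → X.IsOneDimH ξ → X.G.liftsTo ξ P → ¬ X.MnNeZero ξ v →
      ∀ (f' : ((UnitaryGroup.arch (↥(maximalRealSubfield L)) L (IsCMField.complexConj L) 3 H → ℂ) ×
      (∀ v : HeightOneSpectrum (𝓞 ↥(maximalRealSubfield L)), (cmDatum L 3 H).Local v → ℂ))) (f : (CompactlySupportedContinuousMap (cmDatum L 3 (Matrix.of fun i j : Fin 3 => if i.val + j.val + 1 = 3 then (1 : L) else 0)).Adelic ℂ)),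
        (ArchTestKc L ι H T hT f'.1 ∧ (∀ v, IsLocallyConstant (f'.2 v) ∧ HasCompactSupport (f'.2 v)) ∧
        {v | f'.2 v ≠ (cmLocalIntegralLevel L 3 H v : Set ((cmDatum L 3 H).Local v)).indicator fun _ => (1 : ℂ)}.Finite) →
        (Smooth f' ∧ Transfer f' f) → X.G.packetTrace X.tr P f = 0)
    (hvan144H : ∀ (ξ : X.G.PacketH) (v : InnerFormSec146.Place L), v ∈ InnerFormSec146.S0 L H → X.IsOneDimH ξ → ¬ X.MnNeZero ξ v →
      ∀ (f' : ((UnitaryGroup.arch (↥(maximalRealSubfield L)) L (IsCMField.complexConj L) 3 H → ℂ) ×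
      (∀ v : HeightOneSpectrum (𝓞 ↥(maximalRealSubfield L)), (cmDatum L 3 H).Local v → ℂ))) (fH : (CompactlySupportedContinuousMap ((cmDatum L 2 (Matrix.of fun i j : Fin 2 => if i.val + j.val + 1 = 2 then (1 : L) else 0)).Adelic × (cmDatum L 1 (Matrix.of fun i j : Fin 1 => if i.val + j.val + 1 = 1 then (1 : L) else 0)).Adelic) ℂ)),
        (ArchTestKc L ι H T hT f'.1 ∧ (∀ v, IsLocallyConstant (f'.2 v) ∧ HasCompactSupport (f'.2 v)) ∧
        {v | f'.2 v ≠ (cmLocalIntegralLevel L 3 H v : Set ((cmDatum L 3 H).Local v)).indicator fun _ => (1 : ℂ)}.Finite) →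
        TransferH f' fH → X.trH ξ fH = 0)
    (hdef : ∀ τ' : L →+* ℂ, InfinitePlace.mk τ' ≠ InfinitePlace.mk ι → (H.map τ').PosDef)
    (hquad : ∀ v : HeightOneSpectrum (𝓞 ↥(maximalRealSubfield L)), (∀ w : PlacesOver L v, IsCMField.complexConj L • w.1 = w.1) →
      IsQuadraticCharExtension (conjLocal L (IsCMField.complexConj L) v) (μω.semilocalComponent L v))
    (hF1b : ∀ P₀ Q₀ : DiscreteAutomorphicRep (adelicGroupData (↥(maximalRealSubfield L)) L (IsCMField.complexConj L) 3 H) μA,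
      InnerFormSec146.IsKcSpherical L ι H T hT μA P₀ → InnerFormSec146.IsKcSpherical L ι H T hT μA Q₀ →
      P₀.UnitaryEquivOfComponents Q₀ (uFormGroup (Fin 2) (Fin 1)) (cmArchSectionUForm L ι H T hT) (cmCompactFactor L ι H T hT))
    (hARCH : ArchComponentOfDiscrete L ι H T hT μA)
    (p : ∀ ξ : X.G.PacketH, X.IsOneDimH ξ → HeightOneSpectrum (𝓞 ↥(maximalRealSubfield L)) → Prop)
    (hp : ∀ (ξ : X.G.PacketH) (h₁ : X.IsOneDimH ξ) (v : HeightOneSpectrum (𝓞 ↥(maximalRealSubfield L))), p ξ h₁ v →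
      ∀ w : PlacesOver L v, IsCMField.complexConj L • w.1 = w.1)
    (a₀ : ∀ ξ : X.G.PacketH, X.IsOneDimH ξ → GKIrrClass (uFormGroup (Fin 2) (Fin 1)))
    (ha₀ : ∀ (ξ : X.G.PacketH) (h₁ : X.IsOneDimH ξ), ∃ r : GKIrrep (uFormGroup (Fin 2) (Fin 1)), GKIrrClass.mk r = a₀ ξ h₁ ∧ IsAdmissibleGK r.ρK ∧ r.IsInfUnitaryAlongP)
    (hR₁ : ∀ (P : X.G.Packet) (ξ : X.G.PacketH) (h₁ : X.IsOneDimH ξ), X.G.IsAPacket P → X.G.liftsTo ξ P →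
      ∀ φf (f : (CompactlySupportedContinuousMap (cmDatum L 3 (Matrix.of fun i j : Fin 3 => if i.val + j.val + 1 = 3 then (1 : L) else 0)).Adelic ℂ)), (ArchTestKc L ι H T hT φf.1 ∧ (∀ v, IsLocallyConstant (φf.2 v) ∧ HasCompactSupport (φf.2 v)) ∧ {v | φf.2 v ≠ (cmLocalIntegralLevel L 3 H v : Set ((cmDatum L 3 H).Local v)).indicator fun _ => (1 : ℂ)}.Finite) →
      (Smooth φf ∧ Transfer φf f) →
      X.G.packetTrace X.tr P f =
        (-1) ^ (InnerFormSec146.gammaSph _ (CompactlySupportedContinuousMap (cmDatum L 3 (Matrix.of fun i j : Fin 3 => if i.val + j.val + 1 = 3 then (1 : L) else 0)).Adelic ℂ)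
          (CompactlySupportedContinuousMap ((cmDatum L 2 (Matrix.of fun i j : Fin 2 => if i.val + j.val + 1 = 2 then (1 : L) else 0)).Adelic × (cmDatum L 1 (Matrix.of fun i j : Fin 1 => if i.val + j.val + 1 = 1 then (1 : L) else 0)).Adelic) ℂ) L ι H T hT μA
          (xiPacketFamilyOfRecordSCD L H hH hHd μω hμu μZ keys (hSCD_of_cmCharIdentityPackageTestSigned L H hH hHd μω hμu Δ mH mG νG νH μZ hQS)) 𝔩 X).N *
          (archTr₀ L ι H T hT νinf (a₀ ξ h₁) φf.1 *
            ∏ v ∈ (xiTruncOfRecordSCD L H hH hHd μω hμu μZ keys (hSCD_of_cmCharIdentityPackageTestSigned L H hH hHd μω hμu Δ mH mG νG νH μZ hQS) μv (X.oneDimOf ξ h₁) φf.2) with ¬ p ξ h₁ v, (letI : MeasurableSpace ((cmDatum L 3 H).Local v) := borel _;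
              (((xiPacketFamilyOfRecordSCD L H hH hHd μω hμu μZ keys (hSCD_of_cmCharIdentityPackageTestSigned L H hH hHd μω hμu Δ mH mG νG νH μZ hQS)) (X.oneDimOf ξ h₁) v).πn).smoothTrace (μv v) (φf.2 v))) *
          ∏ i ∈ (xiTruncOfRecordSCD L H hH hHd μω hμu μZ keys (hSCD_of_cmCharIdentityPackageTestSigned L H hH hHd μω hμu Δ mH mG νG νH μZ hQS) μv (X.oneDimOf ξ h₁) φf.2).subtype (p ξ h₁), (letI : MeasurableSpace ((cmDatum L 3 H).Local i) := borel _;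
            ((((xiPacketFamilyOfRecordSCD L H hH hHd μω hμu μZ keys (hSCD_of_cmCharIdentityPackageTestSigned L H hH hHd μω hμu Δ mH mG νG νH μZ hQS)) (X.oneDimOf ξ h₁) (i : _)).πn).smoothTrace (μv i) (φf.2 i) -
              (((xiPacketFamilyOfRecordSCD L H hH hHd μω hμu μZ keys (hSCD_of_cmCharIdentityPackageTestSigned L H hH hHd μω hμu Δ mH mG νG νH μZ hQS)) (X.oneDimOf ξ h₁) (i : _)).πs.getD ((xiPacketFamilyOfRecordSCD L H hH hHd μω hμu μZ keys (hSCD_of_cmCharIdentityPackageTestSigned L H hH hHd μω hμu Δ mH mG νG νH μZ hQS)) (X.oneDimOf ξ h₁) (i : _)).πn).smoothTrace (μv i) (φf.2 i))))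
    (hR₂ : ∀ (ξ : X.G.PacketH) (h₁ : X.IsOneDimH ξ), ∀ φf (fH : (CompactlySupportedContinuousMap ((cmDatum L 2 (Matrix.of fun i j : Fin 2 => if i.val + j.val + 1 = 2 then (1 : L) else 0)).Adelic × (cmDatum L 1 (Matrix.of fun i j : Fin 1 => if i.val + j.val + 1 = 1 then (1 : L) else 0)).Adelic) ℂ)), (ArchTestKc L ι H T hT φf.1 ∧ (∀ v, IsLocallyConstant (φf.2 v) ∧ HasCompactSupport (φf.2 v)) ∧ {v | φf.2 v ≠ (cmLocalIntegralLevel L 3 H v : Set ((cmDatum L 3 H).Local v)).indicator fun _ => (1 : ℂ)}.Finite) →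
      TransferH φf fH →
      X.trH ξ fH =
        (-1) ^ (InnerFormSec146.gammaSph _ (CompactlySupportedContinuousMap (cmDatum L 3 (Matrix.of fun i j : Fin 3 => if i.val + j.val + 1 = 3 then (1 : L) else 0)).Adelic ℂ)
          (CompactlySupportedContinuousMap ((cmDatum L 2 (Matrix.of fun i j : Fin 2 => if i.val + j.val + 1 = 2 then (1 : L) else 0)).Adelic × (cmDatum L 1 (Matrix.of fun i j : Fin 1 => if i.val + j.val + 1 = 1 then (1 : L) else 0)).Adelic) ℂ) L ι H T hT μA
          (xiPacketFamilyOfRecordSCD L H hH hHd μω hμu μZ keys (hSCD_of_cmCharIdentityPackageTestSigned L H hH hHd μω hμu Δ mH mG νG νH μZ hQS)) 𝔩 X).N * (InnerFormSec146.gammaSph _ (CompactlySupportedContinuousMap (cmDatum L 3 (Matrix.of fun i j : Fin 3 => if i.val + j.val + 1 = 3 then (1 : L) else 0)).Adelic ℂ)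
          (CompactlySupportedContinuousMap ((cmDatum L 2 (Matrix.of fun i j : Fin 2 => if i.val + j.val + 1 = 2 then (1 : L) else 0)).Adelic × (cmDatum L 1 (Matrix.of fun i j : Fin 1 => if i.val + j.val + 1 = 1 then (1 : L) else 0)).Adelic) ℂ) L ι H T hT μA
          (xiPacketFamilyOfRecordSCD L H hH hHd μω hμu μZ keys (hSCD_of_cmCharIdentityPackageTestSigned L H hH hHd μω hμu Δ mH mG νG νH μZ hQS)) 𝔩 X).c *
          (archTr₀ L ι H T hT νinf (a₀ ξ h₁) φf.1 *
            ∏ v ∈ (xiTruncOfRecordSCD L H hH hHd μω hμu μZ keys (hSCD_of_cmCharIdentityPackageTestSigned L H hH hHd μω hμu Δ mH mG νG νH μZ hQS) μv (X.oneDimOf ξ h₁) φf.2) with ¬ p ξ h₁ v, (letI : MeasurableSpace ((cmDatum L 3 H).Local v) := borel _;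
              (((xiPacketFamilyOfRecordSCD L H hH hHd μω hμu μZ keys (hSCD_of_cmCharIdentityPackageTestSigned L H hH hHd μω hμu Δ mH mG νG νH μZ hQS)) (X.oneDimOf ξ h₁) v).πn).smoothTrace (μv v) (φf.2 v))) *
          ∏ i ∈ (xiTruncOfRecordSCD L H hH hHd μω hμu μZ keys (hSCD_of_cmCharIdentityPackageTestSigned L H hH hHd μω hμu Δ mH mG νG νH μZ hQS) μv (X.oneDimOf ξ h₁) φf.2).subtype (p ξ h₁), (letI : MeasurableSpace ((cmDatum L 3 H).Local i) := borel _;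
            ((((xiPacketFamilyOfRecordSCD L H hH hHd μω hμu μZ keys (hSCD_of_cmCharIdentityPackageTestSigned L H hH hHd μω hμu Δ mH mG νG νH μZ hQS)) (X.oneDimOf ξ h₁) (i : _)).πn).smoothTrace (μv i) (φf.2 i) +
              (((xiPacketFamilyOfRecordSCD L H hH hHd μω hμu μZ keys (hSCD_of_cmCharIdentityPackageTestSigned L H hH hHd μω hμu Δ mH mG νG νH μZ hQS)) (X.oneDimOf ξ h₁) (i : _)).πs.getD ((xiPacketFamilyOfRecordSCD L H hH hHd μω hμu μZ keys (hSCD_of_cmCharIdentityPackageTestSigned L H hH hHd μω hμu Δ mH mG νG νH μZ hQS)) (X.oneDimOf ξ h₁) (i : _)).πn).smoothTrace (μv i) (φf.2 i))))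
    (Pξ : X.G.Packet) (hA : X.G.IsAPacket Pξ)
    (hevpXi : InnerFormSec146.evp L H μA (xiPacketFamilyOfRecordSCD L H hH hHd μω hμu μZ keys (hSCD_of_cmCharIdentityPackageTestSigned L H hH hHd μω hμu Δ mH mG νG νH μZ hQS)) 𝔩
      (InnerFormSec146.piXiPrime L H μA (xiPacketFamilyOfRecordSCD L H hH hHd μω hμu μZ keys (hSCD_of_cmCharIdentityPackageTestSigned L H hH hHd μω hμu Δ mH mG νG νH μZ hQS)) ξ) (X.finOfG Pξ)) :
      ∀ (v : HeightOneSpectrum (𝓞 ↥(maximalRealSubfield L))) (hns : ∀ w : PlacesOver L v, IsCMField.complexConj L • w.1 = w.1),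
      ∀ (T : GL (Fin 3) (LocalRing L v)) (a : LocalRing L v) (ha : IsUnit a)
        (h : formCongr (conjLocal L (IsCMField.complexConj L) v) T (H.map (algebraMap L (LocalRing L v))) =
          a • (Matrix.of fun i j : Fin 3 => if i.val + j.val + 1 = 3 then (1 : L) else 0).map (algebraMap L (LocalRing L v))),
      ∀ [MeasurableSpace (Gqs L v ⧸ Subgroup.center (Gqs L v))] [BorelSpace (Gqs L v ⧸ Subgroup.center (Gqs L v))]
        (μZ : Measure (Gqs L v ⧸ Subgroup.center (Gqs L v))) [μZ.IsHaarMeasure],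
      ∀ (π2 πn : IrrClass (Gqs L v)),
      ∀ (hK : KeysCaseTwoLabels L v (μω.semilocalComponent L v) (torusLocalComponent L (IsCMField.complexConj L) v ξ.η)
          (torusLocalComponent L (IsCMField.complexConj L) v ξ.ψ) π2 πn)
        (hn : ¬ πn.IsSquareIntegrable μZ),
        ∀ c : IrrClass ((cmDatum L 3 H).Local v),
          (IrrClass.comap (localPiEquiv L (IsCMField.complexConj L) 3 H v) c).IsConstituentOf
              (P.finRep.smoothPart.toRepresentation.comp (inclPlace (↥(maximalRealSubfield L)) L (IsCMField.complexConj L) 3 H v)) →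
          c = IrrClass.comap (cmDatumLocalCongr L v T ha h).symm πn ∨
            c = IrrClass.comap (cmDatumLocalCongr L v T ha h).symm π2 ∨
            c = ((hQS ξ).1 v hns T a ha h μZ π2 πn hK hn).πs := by
  have hμ : ∀ v, (letI : MeasurableSpace ((cmDatum L 3 H).Local v) := borel _; (μv v).IsHaarMeasure) := hPH.2.2.1
  have hμK1 : ∀ v, μv v (cmLocalIntegralLevel L 3 H v : Set ((cmDatum L 3 H).Local v)) = 1 := hPH.2.2.2.1
  have hν : (letI : MeasurableSpace (UnitaryGroup.arch (↥(maximalRealSubfield L)) L (IsCMField.complexConj L) 3 H) := borel _; νinf.IsHaarMeasure) := hPH.2.1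
  have hleft : ∀ v, (letI : MeasurableSpace ((cmDatum L 3 H).Local v) := borel _; (μv v).IsMulLeftInvariant) :=
    fun v => letI : MeasurableSpace ((cmDatum L 3 H).Local v) := borel _; (hμ v).toIsMulLeftInvariant
  have hχ𝓕 := chiExpansion_gammaSph_of_allClasses_tensOfPair_levels _ _ L ι H T hT μA _ 𝔩 X ν νinf μv hanis hAFS hPH
    (fun l => InnerFormSec146.IsLevelTest L ι H T hT l) (fun l p hp => ⟨hp.1, hp.2.1, hp.2.2.2⟩) hspecAll htrX
  -- J8-R1∕R2 — (14.6.1) AT `Γ₀` ON THE STABLE ROUTE: Prop. 13.6.1-readings `hG`, `hH61` + vanishing classes + Thm. 14.5.1 (b) (kit shape `h51k`, curried = SEAM 8), ★ `Ch14Bridge.thm1461_of_thm1451b`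
  have h61 := Ch14Bridge.thm1461_of_thm1451b
    (InnerFormSec146.gammaSph _ _ _ L ι H T hT μA (xiPacketFamilyOfRecordSCD L H hH hHd μω hμu μZ keys (hSCD_of_cmCharIdentityPackageTestSigned L H hH hHd μω hμu Δ mH mG νG νH μZ hQS)) 𝔩 X)
    (fun f' f => Smooth f' ∧ Transfer f' f) TransferH hG hH61 hvan hvanH (fun f' f fH hT' hH' => h51k f' f fH hT'.1 ⟨hT'.2, hH'⟩)
  obtain ⟨l₀, hgel⟩ := InnerFormSec146.exists_level_forall_smoothTrace_eq_zero_of_not_isSpherical L H μv hH hHd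
    (fun v => letI : MeasurableSpace ((cmDatum L 3 H).Local v) := borel _; ⟨(hμ v).toIsMulLeftInvariant, inferInstance⟩)
  -- ON THE DEEP LEVELS `{l // l₀ ⊆ l}` (`l₀` = Gelfand level, ★ p04 (c′)): `hlevTA` ((14.6.2) level sums from `h61` AT ONE GRADED PACKET with finitely many lifts, ★ p863577), `hrigD` (S5 core + Gelfand, ★ p04 (e5′)), `hmn` (★ p863655 `…partnerA`), `hcoeffMem` (★ p863643 `…partnerA'`)
  have hlevTA := fun l : {l : InnerFormSec146.Level L // l₀ ⊆ l} =>
    eq1462LevelTsum_at_of_thm1461_of_separation' (InnerFormSec146.gammaSph _ _ _ L ι H T hT μA (xiPacketFamilyOfRecordSCD L H hH hHd μω hμu μZ keys (hSCD_of_cmCharIdentityPackageTestSigned L H hH hHd μω hμu Δ mH mG νG νH μZ hQS)) 𝔩 X) (fun f' f => Smooth f' ∧ Transfer f' f) TransferH h61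
      (InnerFormSec146.IsLevelTest L ι H T hT l.1) (hχ𝓕 l.1) (InnerFormSec146.evOff L H μv l.1) (InnerFormSec146.EvpSupport L H μv l.1) (InnerFormSec146.gradeRep L ι H T hT μA μv l.1) (InnerFormSec146.gradePacket _ _ _ L ι H T hT μA μv _ 𝔩 X l.1) (InnerFormSec146.gradePacketH _ _ _ L ι H T hT μA μv _ 𝔩 X l.1)
      (fun π' e h => InnerFormSec146.gradeRep_mem_evpSupport L ι H T hT μA μv l.1 π' e h) (fun P e h => InnerFormSec146.gradePacket_mem_evpSupport _ _ L ι H T hT μA μv _ 𝔩 X l.1 P e h) (fun ρ e h => InnerFormSec146.gradePacketH_mem_evpSupport _ _ L ι H T hT μA μv _ 𝔩 X l.1 ρ e h)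
      (InnerFormSec146.twistTest L H μv l.1) (tw l.1) (twH l.1) (fun h f' hf' => InnerFormSec146.isLevelTest_twistTest L ι H T hT μv hleft l.1 h f' hf') (hTw l.1) (hTHw l.1) (fun h f' hf' π' => InnerFormSec146.trPrime_twistTest_eq_of_factorised L ι H T hT μA μv _ _ _ 𝔩 X hanis hμ hμK1
        (fun π' φ => archTr₀ L ι H T hT νinf (InnerFormSec146.tupleOf L ι H T hT μA π').1 φ) htrX l.1 (fun v hv c hc => hgel l.1 l.2 v hv c hc) h f' hf' π') (hEP l.1) (hEH l.1) (hsepL l.1) (htP l.1) (hliftE l.1)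
  have hrigD := fun l : {l : InnerFormSec146.Level L // l₀ ⊆ l} => InnerFormSec146.gradeRep_eq_of_evpRigidityCore _ _ L ι H T hT μA μv _ 𝔩 X hanis hμ hμK1
    (fun π' φ => archTr₀ L ι H T hT νinf (InnerFormSec146.tupleOf L ι H T hT μA π').1 φ) htrX l.1 (fun v hv c hc => hgel l.1 l.2 v hv c hc) (hcore l.1)
  have hmn := hmn_of_levels_of_partnerA
    (InnerFormSec146.gammaSph _ _ _ L ι H T hT μA (xiPacketFamilyOfRecordSCD L H hH hHd μω hμu μZ keys (hSCD_of_cmCharIdentityPackageTestSigned L H hH hHd μω hμu Δ mH mG νG νH μZ hQS)) 𝔩 X)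
    (fun f' f => Smooth f' ∧ Transfer f' f) TransferH _ Set.univ (fun π' _ => Set.mem_univ π') hli hex
    (Λ := {l : InnerFormSec146.Level L // l₀ ⊆ l}) (fun l => InnerFormSec146.IsLevelTest L ι H T hT l.1)
    (fun l => InnerFormSec146.gradeRep L ι H T hT μA μv l.1) (fun l => InnerFormSec146.gradePacket _ _ _ L ι H T hT μA μv _ 𝔩 X l.1)
    (fun f' hF P hP => by
      obtain ⟨l, hl, e, hFl, hPl⟩ := hcover𝓣 f' hF P hP l₀
      exact ⟨⟨l, hl⟩, e, hFl, hPl⟩)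
    -- (LF-cut) the `HasSum` level identity AT THE A-PACKET `(P, ξ)` of the (MN) argument: ★ p863577 at `(P, e)` with `|Π̂(P)| < ∞` from `lifts P = {ξ}`, converted POINTWISE (★ p863705 §1)
    (fun l f' f fH hFl hf hfH P ξ hAP h₁ hlift e hP => hasSum_fibre_indicator_of_tsum_eq_at (InnerFormSec146.gammaSph _ _ _ L ι H T hT μA (xiPacketFamilyOfRecordSCD L H hH hHd μω hμu μZ keys (hSCD_of_cmCharIdentityPackageTestSigned L H hH hHd μω hμu Δ mH mG νG νH μZ hQS)) 𝔩 X)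
      (InnerFormSec146.gradeRep L ι H T hT μA μv l.1) f' (hχ𝓕 l.1 f' hFl).1 e (hlevTA l f' f fH hFl hf hfH P e hP ((Set.finite_singleton ξ).subset (hlifts1 P ξ hAP h₁ hlift).subset)))
    (fun l π' P e hP hπ => InnerFormSec146.evpRep_gammaSph_of_grade_eq _ _ L ι H T hT μA μv _ 𝔩 X hμ l.1 π' P e hP hπ)
    (fun l f' hF π' P e hP hevp hne => hrigD l f' hF π' P e hP hevp hne) hlifts1 hn hnH hvan144G hvan144H
  have hcoeffMem := hcoeffMem_binder_gammaSph_recordSCD_atUnitsOfRecord_partnerA' L ι H T hT νinf μv hdef hν hμ hH hHd μω hμu μZ keys _ μA 𝔩 hμω hquad hμK1 hanis hF1b hARCH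
    X (fun f' f => Smooth f' ∧ Transfer f' f) TransferH htrX p hp a₀ ha₀ hR₁ hR₂
    (fun l : {l : InnerFormSec146.Level L // l₀ ⊆ l} => InnerFormSec146.IsLevelTest L ι H T hT l.1)
    (fun l f' h => (hχ𝓕 l.1 f' h).1)
    (fun l => InnerFormSec146.gradeRep L ι H T hT μA μv l.1) (fun l => InnerFormSec146.gradePacket _ _ _ L ι H T hT μA μv _ 𝔩 X l.1)
      -- (CMP-cov) VERDICT (ⅱ): the partner-guarded cover `hcoverP` from the SAME `hcover𝓣` that feeds `hmn` (★ p863134 pays it at `X_cm`)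
      (fun f' _ P hφ hpart _ => by
        obtain ⟨l, hl, e, hF, hP⟩ := hcover𝓣 f' hφ P hpart l₀
        exact ⟨⟨l, hl⟩, e, hF, hP⟩)
    -- (LF-cut) the `tsum` level identity AT THE A-PACKET `(P, ξ)` of the (CMP) argument, `|Π̂(P)| < ∞` from `lifts P = {ξ}`
    (fun l f' f fH hF hf hfH P ξ hA h₁ hl e hP => hlevTA l f' f fH hF hf hfH P e hP ((Set.finite_singleton ξ).subset (hlifts1 P ξ hA h₁ hl).subset))
    (fun l π' P e hP hπ => InnerFormSec146.evpRep_gammaSph_of_grade_eq _ _ L ι H T hT μA μv _ 𝔩 X hμ l.1 π' P e hP hπ)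
    (fun l f' hF π' P e hP hevp hne => hrigD l f' hF π' P e hP hevp hne)
    hlifts1 hn hnH hex
  -- THE ROUTE-AGNOSTIC ENGINE (S1) at `Γ₀`, with (S7) `h64 := sec146_of_levels'` on the deep levels ((δ1)∕(δ6a)'s instantiation, every pin by its ★ name) and (α)'s datum pins
  refine definiteAeRigidityAt_of_thm1461' L H hH hHd Δ mH mG νG νH μω hμu hQS ξ μA P hAE
    (InnerFormSec146.gammaSph _ _ _ L ι H T hT μA (xiPacketFamilyOfRecordSCD L H hH hHd μω hμu μZ keys (hSCD_of_cmCharIdentityPackageTestSigned L H hH hHd μω hμu Δ mH mG νG νH μZ hQS)) 𝔩 X)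
    (fun f' f => Smooth f' ∧ Transfer f' f) TransferH h61
    (sec146_of_levels' _ (fun f' f => Smooth f' ∧ Transfer f' f) TransferH (fun l : {l : InnerFormSec146.Level L // l₀ ⊆ l} => InnerFormSec146.IsLevelTest L ι H T hT l.1) (fun l => hχ𝓕 l.1) (fun l => InnerFormSec146.evOff L H μv l.1) (fun l => InnerFormSec146.EvpSupport L H μv l.1)
      (fun l => InnerFormSec146.gradeRep L ι H T hT μA μv l.1) (fun l => InnerFormSec146.gradePacket _ _ _ L ι H T hT μA μv _ 𝔩 X l.1) (fun l => InnerFormSec146.gradePacketH _ _ _ L ι H T hT μA μv _ 𝔩 X l.1) (fun l π' e h => InnerFormSec146.gradeRep_mem_evpSupport L ι H T hT μA μv l.1 π' e h)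
      (fun l P e h => InnerFormSec146.gradePacket_mem_evpSupport _ _ L ι H T hT μA μv _ 𝔩 X l.1 P e h) (fun l ρ e h => InnerFormSec146.gradePacketH_mem_evpSupport _ _ L ι H T hT μA μv _ 𝔩 X l.1 ρ e h) (fun l => InnerFormSec146.twistTest L H μv l.1) (fun l => tw l.1) (fun l => twH l.1)
      (fun l h f' hf' => InnerFormSec146.isLevelTest_twistTest L ι H T hT μv hleft l.1 h f' hf') (fun l => hTw l.1) (fun l => hTHw l.1) (fun l h f' hf' π' => InnerFormSec146.trPrime_twistTest_eq_of_factorised L ι H T hT μA μv _ _ _ 𝔩 X hanis hμ hμK1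
        (fun π' φ => archTr₀ L ι H T hT νinf (InnerFormSec146.tupleOf L ι H T hT μA π').1 φ) htrX l.1 (fun v hv c hc => hgel l.1 l.2 v hv c hc) h f' hf' π') (fun l => hEP l.1) (fun l => hEH l.1) (fun l => hsepL l.1) (fun l ρ e h => InnerFormSec146.exists_gradePacket_of_gradePacketH _ _ _ L ι H T hT μA μv _ 𝔩 X l.1 ρ e h)
      (fun π' hm => by
        obtain ⟨l, hl, e, f₀, f, fH, h⟩ := hcoverR π' hm l₀
        exact ⟨⟨l, hl⟩, e, f₀, f, fH, h⟩) (fun l π' P e hP hπ => InnerFormSec146.evpRep_gammaSph_of_grade_eq _ _ L ι H T hT μA μv _ 𝔩 X hμ l.1 π' P e hP hπ) (fun π' P Q hP hQ => by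
        obtain ⟨l, hl, e, h₁, h₂⟩ := InnerFormSec146.exists_level_gradePacket_eq_of_evpRep _ _ _ L ι H T hT μA μv _ 𝔩 X hanis hframe π' P Q hP hQ l₀
        exact ⟨⟨l, hl⟩, e, h₁, h₂⟩) (fun l P Q e hP hQ => htP l.1 P Q e hP hQ) (fun π' P' Q hm' => InnerFormSec146.evpRep_iff_evp_of_memPrime L H μA _ hanis (pisSlotsNotSphericalCofinite_recordSCD L H hH hHd μω hμu μZ keys _) 𝔩 π'.1 P' hm' (X.finOfG Q)) (fun π' _ => InnerFormSec146.exists_memPrime L H μA _ hanis π'.1)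
      (fun π' P' Q' hP' hQ' => InnerFormSec146.memPrime_unique L H μA _ hanis hDisj π'.1 P' Q' hP' hQ') htri hApkt hmn hcoeffMem)
    (InnerFormSec146.gammaSph_dSplit _ _ _ L ι H T hT μA _ 𝔩 X) (InnerFormSec146.classOfSph L ι H T hT μA P hsph)
    (InnerFormSec146.gammaSph_m'_ne_zero _ _ _ L ι H T hT μA _ 𝔩 X hanis _) Pξ hA (aeString_of_ae L H hH hHd hanis μω hμu hμω ξ μA P) (fun _ => ?_) ?_
  · -- `hevp` at the datum: (AE) + «t(Π′(ξ)) = t(Π(ξ))» ⟹ «t(P) = t(Π(ξ))» (α2), read back by `rfl`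
    exact (InnerFormSec146.gammaSph_evpRep_classOfSph _ _ _ L ι H T hT μA _ 𝔩 X P hsph Pξ).2 ((InnerFormSec146.evpRep_classOf L H μA 𝔩 P (X.finOfG Pξ)).1 (evpRep_of_ae_of_evp_piXiPrime L H hH hHd Δ mH mG νG νH μω hμu hQS μZ keys ξ μA P hanis hAE 𝔩 (X.finOfG Pξ) hevpXi))
  · -- `hback` at the datum: membership in `Π′(ξ′)` READ BACK (★ `gammaSph_mem'_piXi'_classOfSph`), then the signed read-back of the record (α1)
    intro ξ' h₁ hS _ hmem
    exact sgTail_of_ae_of_recordSCD L H hH hHd Δ mH mG νG νH μω hμu hQS μZ keys (hSCD_of_cmCharIdentityPackageTestSigned L H hH hHd μω hμu Δ mH mG νG νH μZ hQS) hanis hμω (fun ξ₂ v hns T₂ a₂ ha₂ h₂ π2 πn hK hn => hSCD_of_cmCharIdentityPackageTestSigned_fst L H hH hHd μω hμu Δ mH mG νG νH μZ hQS ξ₂ v hns T₂ a₂ ha₂ h₂ π2 πn hK hn)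
      ξ μA P hAE (X.oneDimOf ξ' h₁) ((InnerFormSec146.gammaSph_mem'_piXi'_classOfSph _ _ _ L ι H T hT μA _ 𝔩 X P hsph ξ' h₁ hS).1 hmem)

end Summit.HodgeConjecture.HodgeConjecture.R90.S9

end
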